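import Summits.PneNP.PneNP.Theorems.ChebyshevTracialDesignReducedSpreadCell
import Summits.PneNP.PneNP.Theorems.ChebyshevTracialDesignSquareSlackDesign
import HarnessLib

/-!
# Cell pnp-psdrank, route `ChebyshevTracialDesign`: **NTF mod KL** — every exact design of degree `≍ dq n` decays, up to its variation, on ALL
# rectangles (no tight-freeness); in particular the squared-slack design `W·(cc−1)²` of the crux's necessary condition at polynomial dimension

Harmonic backbone of the crux `TracialDecayExp20` (stmt-PneNP-19878), brick 50c (prover g10; MEMO-12 §3 «next prover (0)», lit g16 I15). THEOREM
**`rectangleDecayAll_of_globalLevelD`**: assume the named fact `GlobalLevelDInequality` [cite: KeevashLifshitz2023, Thm. 1.8]. There are `a > 0`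
and `n₁` such that for every even `n ≥ n₁`, every exact design `(n, t = 2c'+1, T, D, B, C, w)` with `n ≤ 4t`, `T ≤ Tq n`, `dq n − 2 ≤ D ≤ dq n`
and ANY variation bound `B`, and EVERY rectangle `A × Y` of odd cuts × perfect matchings:
`Σ_{U∈A} Σ_{M∈Y} W(U,M) ≤ B·exp(−a·dq n)`. COROLLARY **`rectangleSqSlackDecay_of_globalLevelD`**: for the balanced `B = 20` designs of the
route and the squared-slack reweighting `w̃_c = w_c(c−1)²` (brick 43: exact of degree `dq n − 2`, variation `≤ 20·Tq(n)²`),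
`Σ_{A × Y} W̃ ≤ 20·Tq(n)²·exp(−a·dq n)` on ALL rectangles — the `r = 1` statement NTF that the crux implies at dimension `C(n,2)+1`
(lit `TracialPureStateWitness.rectCcSq_le_of_tracialValueLEAt`, prover g9 `rect_sqSlack_decay_of_crux`), now PROVED modulo KL: the cheapest
refutation locus of the crux at polynomial dimension is closed (conditionally on Thm 1.8), and MEMO-12 §4(d) is certified.
PROOF. Brick 50a `value_le_three_terms` with `τ = e`, `q = ⌈a dq n⌉ + 4`, `a = c₀/80`, threshold `β = exp(−c₀(dq n − 1))`, the reduced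
spread-cell bound of brick 50b (`Ψ = e^{2000}√P*`) in every reduced instance `m ≥ n − 2q`, and the constants: remainder and crossing terms as in
brick 32 (`…RungConstants`), the junk term with the extra `4^q` (`junk_term_le'`), and the spread-cell term through `e^{2000} ≤ n^q` (`q ≥ 84`,
`n ≥ e^{25}`) and `P*·D^{3κ*} ≤ 2^{κ*}`. [cite: Rothvoss2017, §2 and Lemma 7 (PDF pp. 6–8)] [cite: KupavskiiZakharov2022, Lemma 11]
[cite: KeevashLifshitz2023, Thm. 1.8] [cite: Grigoriev2001, Lemma 1.4 (PDF p. 8)]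
Stature: support/instrument — CONDITIONAL (on KL Thm 1.8) theorem about 0/1 rectangles. WHAT THIS IS NOT: not the crux `TracialDecayExp20`
(dimension up to `exp(a dq n/2)`), no proof of KL Thm 1.8, nothing on psd rank, no P-vs-NP content. Supports stmt-PneNP-19878.
-/

set_option linter.dupNamespace false -- `Summit.PneNP.PneNP.…`: summit = sub-problem (D-0017)

noncomputable section

namespace Summit.PneNP.PneNP.Theorems.ChebyshevTracialDesignRectangleDecayAll

open Finset Literature.Combinatorics.Optimization
open Literature.Barriers.PneNP hiding verts
open Literature.Combinatorics.SetFamily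
open Literature.Combinatorics.SimpleGraph.CycleSpace
open Literature.Combinatorics.AssociationSchemes.CutMatchingRestriction
open Literature.Combinatorics.AssociationSchemes.HomogeneousMatchingFamilies
open Literature.Combinatorics.Additive.KeevashLifshitz
open Summit.PneNP.PneNP.Theorems.ChebyshevTracialDesignSpectralNonTightnessEstimates (atten_le_pow atten_nonneg)
open Summit.PneNP.PneNP.Theorems.ChebyshevTracialDesignRungConstants
open Summit.PneNP.PneNP.Theorems.ChebyshevTracialDesignRungAssembly (levelWeight_eq_zero_of_card_ne)
open Summit.PneNP.PneNP.Theorems.ChebyshevTracialDesignRungAssemblyAll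
open Summit.PneNP.PneNP.Theorems.ChebyshevTracialDesignReducedSpreadCell
open Summit.PneNP.PneNP.Theorems.ChebyshevTracialDesignSquareSlackDesign

variable {n : ℕ}

/-! ### §1 Constants -/

/-- `4 ≤ e²`. [folklore] -/
theorem four_le_exp_two : (4 : ℝ) ≤ Real.exp 1 ^ 2 := by
  have h := Real.exp_one_gt_d9
  nlinarith

/-- **Junk term with the pattern count**: `2·4^q·e^{q+1}·exp(−c₀(D−1)) ≤ exp(−(c₀/80)D)/6` once `c₀ ≤ 1`, `c₀D ≥ 32`, `q+1 ≤ (c₀/80)D + 6`.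
[cite: KupavskiiZakharov2022, Lemma 11] -/
theorem junk_term_le' {c₀ D : ℝ} {q : ℕ} (hc₀1 : c₀ ≤ 1) (hcD : 32 ≤ c₀ * D) (hq : (q : ℝ) + 1 ≤ c₀ / 80 * D + 6) :
    2 * (4 : ℝ) ^ q * Real.exp 1 ^ (q + 1) * Real.exp (-(c₀ * (D - 1))) ≤ Real.exp (-(c₀ / 80 * D)) / 6 := by
  have h4 : (4 : ℝ) ^ q ≤ Real.exp 1 ^ (2 * q) := by
    rw [pow_mul]; exact pow_le_pow_left₀ (by norm_num) four_le_exp_two q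
  have h1 : 2 * (4 : ℝ) ^ q * Real.exp 1 ^ (q + 1) * Real.exp (-(c₀ * (D - 1))) ≤
      2 * Real.exp (((2 * q : ℕ) : ℝ) + ((q + 1 : ℕ) : ℝ) + -(c₀ * (D - 1))) := by
    rw [Real.exp_add, Real.exp_add, ← Real.exp_one_pow, ← Real.exp_one_pow]
    have hA := Real.exp_pos (-(c₀ * (D - 1)))
    have hB := pow_pos (Real.exp_pos 1) (q + 1)
    have h2 : 2 * (4 : ℝ) ^ q * Real.exp 1 ^ (q + 1) * Real.exp (-(c₀ * (D - 1))) =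
        (4 : ℝ) ^ q * (2 * Real.exp 1 ^ (q + 1) * Real.exp (-(c₀ * (D - 1)))) := by ring
    rw [h2, show 2 * (Real.exp 1 ^ (2 * q) * Real.exp 1 ^ (q + 1) * Real.exp (-(c₀ * (D - 1)))) =
        Real.exp 1 ^ (2 * q) * (2 * Real.exp 1 ^ (q + 1) * Real.exp (-(c₀ * (D - 1)))) by ring]
    exact mul_le_mul_of_nonneg_right h4 (by positivity)
  have hexp : ((2 * q : ℕ) : ℝ) + ((q + 1 : ℕ) : ℝ) + -(c₀ * (D - 1)) ≤ -(c₀ / 80 * D) + -13 := by push_cast; nlinarith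
  have h2 : Real.exp (((2 * q : ℕ) : ℝ) + ((q + 1 : ℕ) : ℝ) + -(c₀ * (D - 1))) ≤ Real.exp (-(c₀ / 80 * D)) * Real.exp (-13) := by
    rw [← Real.exp_add]; exact Real.exp_le_exp.2 hexp
  have he13 : Real.exp (-13) * 12 ≤ 1 := by
    rw [Real.exp_neg, inv_mul_le_iff₀ (Real.exp_pos 13), mul_one]
    have h := sixty_le_exp_one_pow_five
    have h' : Real.exp 1 ^ 5 ≤ Real.exp 1 ^ 13 :=
      pow_le_pow_right₀ (by have := Real.add_one_le_exp (1 : ℝ); linarith) (by norm_num)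
    have h'' := h.trans h'
    rw [Real.exp_one_pow, Nat.cast_ofNat] at h''
    linarith
  have hpos : 0 < Real.exp (-(c₀ / 80 * D)) := Real.exp_pos _
  nlinarith [mul_le_mul_of_nonneg_left he13 hpos.le]

/-- `e^{25} ≤ 600⁴`. [folklore] -/
theorem exp_25_le : Real.exp 25 ≤ (600 : ℝ) ^ 4 := by
  have h := Real.exp_one_lt_d9
  have h0 := (Real.exp_pos 1).le
  have h25 : Real.exp 25 = Real.exp 1 ^ 25 := by rw [← Real.exp_nat_mul]; norm_num
  rw [h25]
  calc Real.exp 1 ^ 25 ≤ (2.7182818286 : ℝ) ^ 25 := pow_le_pow_left₀ h0 h.le 25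
    _ ≤ (600 : ℝ) ^ 4 := by norm_num

/-- **`e^{2000} ≤ n^q`** for `q ≥ 80` and `n ≥ 600⁴`. [folklore] -/
theorem exp_2000_le_pow {q : ℕ} (hq : 80 ≤ q) (hn : 600 ^ 4 ≤ n) : Real.exp 2000 ≤ (n : ℝ) ^ q := by
  have hn' : Real.exp 25 ≤ n := exp_25_le.trans (by exact_mod_cast hn)
  have h1 : Real.exp 2000 = Real.exp 25 ^ 80 := by rw [← Real.exp_nat_mul]; norm_num
  rw [h1]
  calc Real.exp 25 ^ 80 ≤ (n : ℝ) ^ 80 := pow_le_pow_left₀ (Real.exp_pos _).le hn' 80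
    _ ≤ (n : ℝ) ^ q := pow_le_pow_right₀ (by
        have : (1 : ℝ) ≤ Real.exp 25 := by have := Real.add_one_le_exp (25 : ℝ); linarith
        exact this.trans hn') hq

/-- The reduced tail product is below `(4κ/n)^κ` (`4q + 4κ ≤ n`). [cite: GodsilMeagher2015, §15.2] -/
theorem prod_reduced_le_pow {q κ : ℕ} (h : 4 * q + 4 * κ ≤ n) (hn : 1 ≤ n) :
    ∏ i ∈ range κ, ((2 * i + 1 : ℝ) / ((n : ℝ) - 2 * q - 2 * i)) ≤ ((4 * κ : ℝ) / n) ^ κ := by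
  rw [show ((4 * κ : ℝ) / n) ^ κ = ∏ _i ∈ range κ, ((4 * κ : ℝ) / n) by rw [prod_const, card_range]]
  · refine prod_le_prod (fun i hi => ?_) fun i hi => ?_
    · have := mem_range.1 hi
      have : (2 * q + 2 * i : ℝ) < n := by exact_mod_cast (show 2 * q + 2 * i < n by omega)
      exact div_nonneg (by positivity) (by linarith)
    · have hi' := mem_range.1 hi
      have hn0 : (0 : ℝ) < n := by exact_mod_cast (show 0 < n by omega)
      have hd : (n : ℝ) / 2 ≤ (n : ℝ) - 2 * q - 2 * i := by
        have : (4 * q + 4 * i : ℝ) ≤ n := by exact_mod_cast (show 4 * q + 4 * i ≤ n by omega)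
        linarith
      have hnum : (2 * i + 1 : ℝ) ≤ 2 * κ := by exact_mod_cast (show 2 * i + 1 ≤ 2 * κ by omega)
      calc (2 * i + 1 : ℝ) / ((n : ℝ) - 2 * q - 2 * i) ≤ (2 * κ : ℝ) / ((n : ℝ) / 2) :=
            div_le_div₀ (by positivity) hnum (by positivity) hd
        _ = (4 * κ : ℝ) / n := by field_simp; ring

/-! ### §2 NTF mod KL -/

set_option maxHeartbeats 800000 in
/-- **EVERY EXACT DESIGN OF DEGREE `≍ dq n` DECAYS ON ALL RECTANGLES, up to its variation (modulo Keevash–Lifshitz Thm 1.8).**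
See the module docstring. [cite: KeevashLifshitz2023, Thm. 1.8] [cite: Rothvoss2017, §2 and Lemma 7 (PDF pp. 6–8)] [cite: KupavskiiZakharov2022, Lemma 11] -/
theorem rectangleDecayAll_of_globalLevelD (hKL : GlobalLevelDInequality) :
    ∃ a : ℝ, 0 < a ∧ ∃ n₁ : ℕ, ∀ n : ℕ, n₁ ≤ n → Even n → ∀ (c' T Dg : ℕ) (Bv : ℝ) (C : Finset ℕ) (w : ℕ → ℝ),
      IsExactDesign n (2 * c' + 1) T Dg Bv C w → n ≤ 4 * (2 * c' + 1) → T ≤ Tq n → dq n ≤ Dg + 2 → Dg ≤ dq n →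
        ∀ (A : Finset (OddSet n)) (B : Finset (PMatch n)),
          ∑ U ∈ A, ∑ M ∈ B, levelWeight n (2 * c' + 1) C w U M ≤ Bv * Real.exp (-(a * (dq n : ℝ))) := by
  classical
  have hτ1 : (1 : ℝ) ≤ Real.exp 1 := by have := Real.add_one_le_exp (1 : ℝ); linarith
  have hτ0 : (0 : ℝ) < Real.exp 1 := Real.exp_pos 1
  obtain ⟨c₀, hc₀, hc₀1, n₀, hred⟩ := reduced_spreadCell_value_le_of_globalLevelD hKL
  obtain ⟨a, ha⟩ : ∃ a : ℝ, a = c₀ / 80 := ⟨_, rfl⟩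
  have ha0 : 0 < a := by rw [ha]; positivity
  obtain ⟨D₁, hD₁⟩ : ∃ D₁ : ℕ, D₁ = max 1000 ⌈6400 / c₀⌉₊ := ⟨_, rfl⟩
  refine ⟨a, ha0, max (2 * n₀ + 28) (D₁ ^ 4), ?_⟩
  intro n hn hev c' T Dg Bv C w hdes hbal hTT hDg2 hDgD A B
  have hex := hdes
  -- the size parameter `D = dq n`
  have hN₀ : 2 * n₀ + 28 ≤ n := le_trans (le_max_left _ _) hn
  have hD₁n : D₁ ^ 4 ≤ n := le_trans (le_max_right _ _) hn
  have hD : D₁ ≤ dq n := by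
    unfold dq
    rw [Nat.le_sqrt, Nat.le_sqrt]
    calc D₁ * D₁ * (D₁ * D₁) = D₁ ^ 4 := by ring
      _ ≤ n := hD₁n
  have hD1000 : 1000 ≤ dq n := le_trans (by rw [hD₁]; exact le_max_left _ _) hD
  have hDc : ⌈6400 / c₀⌉₊ ≤ dq n := le_trans (by rw [hD₁]; exact le_max_right _ _) hD
  have hcD : 6400 ≤ c₀ * dq n := by
    have h1 : 6400 / c₀ ≤ (dq n : ℝ) := (Nat.le_ceil _).trans (by exact_mod_cast hDc)
    rwa [div_le_iff₀ hc₀, mul_comm] at h1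
  have hD4n : dq n ^ 4 ≤ n := by
    have h1 : dq n * dq n ≤ Nat.sqrt n := Nat.sqrt_le (Nat.sqrt n)
    calc dq n ^ 4 = (dq n * dq n) * (dq n * dq n) := by ring
      _ ≤ Nat.sqrt n * Nat.sqrt n := Nat.mul_le_mul h1 h1
      _ ≤ n := Nat.sqrt_le n
  have hD2 : dq n * dq n ≤ dq n ^ 4 := by
    calc dq n * dq n = dq n * dq n * 1 := (mul_one _).symm
      _ ≤ dq n * dq n * (dq n * dq n) := Nat.mul_le_mul_left _ (Nat.one_le_iff_ne_zero.2 (by positivity))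
      _ = dq n ^ 4 := by ring
  have hDDn : dq n * dq n ≤ n := hD2.trans hD4n
  have h1000D : 1000 * dq n ≤ n := by nlinarith
  have hnD : n < (dq n + 1) ^ 4 := by
    have h1 := Nat.lt_succ_sqrt' n
    have h2 := Nat.lt_succ_sqrt' (Nat.sqrt n)
    have h3 : Nat.sqrt n + 1 ≤ (dq n + 1) ^ 2 := h2
    calc n < (Nat.sqrt n + 1) ^ 2 := h1
      _ ≤ ((dq n + 1) ^ 2) ^ 2 := Nat.pow_le_pow_left h3 2
      _ = (dq n + 1) ^ 4 := by ring
  have hn16 : (n : ℝ) ≤ 16 * (dq n : ℝ) ^ 4 := by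
    have h1 : n ≤ (2 * dq n) ^ 4 := hnD.le.trans (Nat.pow_le_pow_left (by omega) 4)
    have h2 : ((n : ℕ) : ℝ) ≤ (((2 * dq n) ^ 4 : ℕ) : ℝ) := by exact_mod_cast h1
    have h3 : (((2 * dq n) ^ 4 : ℕ) : ℝ) = 16 * (dq n : ℝ) ^ 4 := by push_cast; ring
    linarith
  -- `sqrt n` and `Tq n`
  have hs1000 : 1000 ≤ Nat.sqrt n := by
    rw [Nat.le_sqrt]
    have : dq n ≤ Nat.sqrt n := Nat.sqrt_le_self _
    nlinarith
  have hss : Nat.sqrt n * Nat.sqrt n ≤ n := Nat.sqrt_le n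
  have hs200 : 1000 * Nat.sqrt n ≤ n := by nlinarith
  have hTq : T ≤ 4 * Nat.sqrt n + 3 := hTT
  have hT200 : 200 * T ≤ n := by omega
  have hT49 : T * T ≤ 49 * n := by nlinarith
  -- the core size `q`
  obtain ⟨q, hq⟩ : ∃ q : ℕ, q = ⌈a * dq n⌉₊ + 4 := ⟨_, rfl⟩
  have hq1 : a * dq n + 5 ≤ (q : ℝ) + 1 := by
    rw [hq]; push_cast; linarith [Nat.le_ceil (a * dq n)]
  have hq2 : (q : ℝ) + 1 ≤ a * dq n + 6 := by
    rw [hq]; push_cast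
    have := Nat.ceil_lt_add_one (show 0 ≤ a * dq n by positivity); linarith
  have hq80 : 80 * q < dq n + 480 := by
    have hcd : c₀ * dq n ≤ dq n := by nlinarith [Nat.cast_nonneg (α := ℝ) (dq n)]
    have h1 : (80 : ℝ) * q < dq n + 480 := by rw [ha] at hq2; linarith
    exact_mod_cast h1
  have hq84 : 84 ≤ q := by
    have h1 : (80 : ℝ) ≤ a * dq n := by rw [ha]; linarith
    have h2 : (84 : ℝ) ≤ (q : ℝ) := by linarith
    exact_mod_cast h2
  have hq40 : 40 * q ≤ n := by omega
  have h2q : 2 * q ≤ dq n := by omega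
  have hn1 : 1 ≤ n := by omega
  -- the design
  have ht2 : 2 * (2 * c' + 1) + 2 ≤ n := hex.2.1
  have hTt : T ≤ 2 * c' + 1 := hex.2.2.1
  have hDg : Dg ≤ 2 * c' := by omega
  have hDg4 : 4 ≤ Dg := by omega
  have hTq2 : T + 2 * q + 2 ≤ 2 * c' + 1 := by omega
  have hqD : q ≤ Dg := by omega
  have hDq3 : Dg + 2 * q + 3 ≤ 2 * c' + 1 := by omega
  have hqN : 2 * q * q + q ≤ n / 2 := by
    have h1 : q ≤ dq n := by omega
    have h2 : 2 * q * q + q ≤ 3 * (dq n * dq n) := by nlinarith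
    have h3 : 6 * (dq n * dq n) ≤ n := by nlinarith
    omega
  have hBv : 0 ≤ Bv := (sum_nonneg fun c _ => abs_nonneg (w c)).trans hex.2.2.2.2.2.2
  -- the spread approximation of the matching side
  obtain ⟨Dk⟩ := exists_spreadApproximation (image_val_subset B) hτ1 q
  -- the junk threshold `β = exp(−c₀(D−1))`
  have hβ : ∀ m : ℕ, n ≤ m + 2 * q → m ≤ n → Real.exp (-(c₀ * dq m)) ≤ Real.exp (-(c₀ * ((dq n : ℝ) - 1))) := by
    intro m hm1 _
    have hdm : dq n - 1 ≤ dq m := dq_pred_le (n := n) hm1 h2q (by omega)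
    apply Real.exp_le_exp.2
    have h3 : ((dq n : ℝ) - 1) ≤ (dq m : ℝ) := by
      have : ((dq n - 1 : ℕ) : ℝ) ≤ dq m := by exact_mod_cast hdm
      rwa [Nat.cast_sub (by omega), Nat.cast_one] at this
    nlinarith
  -- the reduced spread-cell bound (brick 50b) as the hypothesis `hVNS` with `n₁ := n − 2q`
  set Pstar : ℝ := ∏ i ∈ range ((Dg - q) / 2 + 1), ((2 * i + 1 : ℝ) / ((n : ℝ) - 2 * q - 2 * i)) with hPstar
  have hPstar0 : 0 ≤ Pstar := by
    refine prod_nonneg fun i hi => ?_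
    have := mem_range.1 hi
    have : (2 * q + 2 * i : ℝ) < n := by exact_mod_cast (show 2 * q + 2 * i < n by omega)
    exact div_nonneg (by positivity) (by linarith)
  have hΨ0 : 0 ≤ Real.exp 2000 * Real.sqrt Pstar := by positivity
  have hC3 : ∀ c ∈ C, Odd c ∧ 3 ≤ c ∧ c ≤ T := fun c hc => ⟨(hex.2.2.2.1 c hc).1, (hex.2.2.2.1 c hc).2.1, (hex.2.2.2.1 c hc).2.2.1⟩
  have hVNS := fun (m t'' D' : ℕ) (w' : ℕ → ℝ) (hm : n - 2 * q ≤ m) (hme : Even m) (hto : Odd t'') (h5 : m ≤ 5 * t'')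
      (h5' : m ≤ 5 * (m - t'')) (hT1 : T ≤ t'') (hT2 : T ≤ m - t'') (hD1 : D' + 3 ≤ t'') (hD2' : D' + 3 ≤ m - t'')
      (hDq' : Dg ≤ D' + q) (hD'Dg : D' ≤ Dg) (hQ : ∀ c ∈ C, (Qset m t'' c).Nonempty)
      (hexact' : ∀ p : Polynomial ℝ, p.natDegree ≤ D' → ∑ c ∈ C, w' c * p.eval (c : ℝ) = -p.eval 0)
      (hvar' : ∑ c ∈ C, |w' c| ≤ Bv) (X : Finset (OddSet m)) (hX : ∀ U ∈ X, U.1.card = t'') (Y' : Finset (PMatch m))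
      (hhom : IsRelHomogeneous (Real.exp 1) (perfectMatchings (univ : Finset (Fin m))) (Y'.image Subtype.val))
      (hdX : Real.exp (-(c₀ * dq m)) ≤ (X.card : ℝ) / (m.choose t'' : ℝ))
      (hdY : Real.exp (-(c₀ * dq m)) ≤ (Y'.card : ℝ) / (Fintype.card (PMatch m) : ℝ)) =>
    hred n q Dg T Bv C hC3 hT49 hT200 hq40 h2q hDgD (by omega) (by omega) m t'' D' w' (by omega) (by omega) hme hto h5 h5'
      hT1 hT2 hD1 hD2' hDq' hD'Dg hQ hexact' hvar' X hX Y' hhom hdX hdY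
  -- reduce `A` to the `t`-cuts
  have hAeq : ∑ U ∈ A, ∑ M ∈ B, levelWeight n (2 * c' + 1) C w U M =
      ∑ U ∈ A.filter (fun U => U.1.card = 2 * c' + 1), ∑ M ∈ B, levelWeight n (2 * c' + 1) C w U M := by
    rw [sum_filter]
    refine sum_congr rfl fun U _ => ?_
    split_ifs with hU
    · rfl
    · exact sum_eq_zero fun M _ => levelWeight_eq_zero_of_card_ne C w hU M
  have hAtcard : ∀ U ∈ A.filter (fun U => U.1.card = 2 * c' + 1), U.1.card = 2 * c' + 1 := fun U hU => (mem_filter.1 hU).2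
  -- the three-term bound
  have h3 := value_le_three_terms (n₁ := n - 2 * q) hev hn1 hex hDg hDg4 hbal hq40 (by omega) hTq2 hqD hDq3 hqN hτ0 hVNS hΨ0 hβ
    (Real.exp_pos _).le (A.filter fun U => U.1.card = 2 * c' + 1) hAtcard B Dk
  -- the attenuation `P_{Dg−4}` and `P*`
  have hDpos : (0 : ℝ) < dq n := by exact_mod_cast (show 0 < dq n by omega)
  have hn0 : (0 : ℝ) < n := by exact_mod_cast (show 0 < n by omega)
  have hD4R : (dq n : ℝ) ^ 4 ≤ n := by exact_mod_cast hD4n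
  have hκ : 18 * q + 18 ≤ (Dg - 4) / 2 + 1 := by omega
  have hκn : 4 * ((Dg - 4) / 2 + 1) ≤ n := by omega
  have hP := atten_le_pow (n := n) hκn
  have hP0 : 0 ≤ ∏ i ∈ range ((Dg - 4) / 2 + 1), ((2 * i + 1 : ℝ) / ((n : ℝ) - 2 * i)) := atten_nonneg (by omega)
  have hratio : ∀ κ : ℕ, 4 * κ ≤ 2 * dq n → (4 * (κ : ℝ)) / n ≤ 2 / (dq n : ℝ) ^ 3 := by
    intro κ hκ2D
    rw [div_le_div_iff₀ hn0 (by positivity)]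
    have h1 : (4 * (κ : ℝ)) ≤ 2 * dq n := by exact_mod_cast hκ2D
    calc 4 * (κ : ℝ) * (dq n : ℝ) ^ 3 ≤ 2 * dq n * (dq n : ℝ) ^ 3 := mul_le_mul_of_nonneg_right h1 (by positivity)
      _ = 2 * (dq n : ℝ) ^ 4 := by ring
      _ ≤ 2 * n := by linarith
  have hP' : (∏ i ∈ range ((Dg - 4) / 2 + 1), ((2 * i + 1 : ℝ) / ((n : ℝ) - 2 * i))) * (dq n : ℝ) ^ (3 * ((Dg - 4) / 2 + 1)) ≤
      (2 : ℝ) ^ ((Dg - 4) / 2 + 1) := by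
    have hr := hratio ((Dg - 4) / 2 + 1) (by omega)
    have hP2 := hP.trans (pow_le_pow_left₀ (by positivity) (by push_cast at hr ⊢; exact hr) _)
    calc _ ≤ (2 / (dq n : ℝ) ^ 3) ^ ((Dg - 4) / 2 + 1) * (dq n : ℝ) ^ (3 * ((Dg - 4) / 2 + 1)) :=
          mul_le_mul_of_nonneg_right hP2 (by positivity)
      _ = (2 : ℝ) ^ ((Dg - 4) / 2 + 1) := by
          rw [div_pow, ← pow_mul, div_mul_cancel₀]
          exact pow_ne_zero _ hDpos.ne'
  have hκs : 18 * q + 18 ≤ (Dg - q) / 2 + 1 := by omega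
  have hPs := prod_reduced_le_pow (n := n) (q := q) (κ := (Dg - q) / 2 + 1) (by omega) hn1
  have hPs' : Pstar * (dq n : ℝ) ^ (3 * ((Dg - q) / 2 + 1)) ≤ (2 : ℝ) ^ ((Dg - q) / 2 + 1) := by
    have hr := hratio ((Dg - q) / 2 + 1) (by omega)
    have hP2 := hPs.trans (pow_le_pow_left₀ (by positivity) (by push_cast at hr ⊢; exact hr) _)
    calc _ ≤ (2 / (dq n : ℝ) ^ 3) ^ ((Dg - q) / 2 + 1) * (dq n : ℝ) ^ (3 * ((Dg - q) / 2 + 1)) :=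
          mul_le_mul_of_nonneg_right hP2 (by positivity)
      _ = (2 : ℝ) ^ ((Dg - q) / 2 + 1) := by
          rw [div_pow, ← pow_mul, div_mul_cancel₀]
          exact pow_ne_zero _ hDpos.ne'
  -- the four terms
  have hT1 := remainder_term_le hq1
  have hT2 := crossing_term_le (a := a) hP0 hP' (by omega : 2 ≤ dq n) hn16 hκ (by linarith)
  have hq2' : (q : ℝ) + 1 ≤ c₀ / 80 * dq n + 6 := by rw [ha] at hq2; exact hq2
  have hT3 := junk_term_le' (D := (dq n : ℝ)) hc₀1 (by linarith) hq2'
  rw [← ha] at hT3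
  have hT4core := crossing_term_le (a := a) hPstar0 hPs' (by omega : 2 ≤ dq n) hn16 hκs (by linarith)
  have h600 : 600 ^ 4 ≤ n := by
    have h1 : 600 ≤ D₁ := by rw [hD₁]; exact le_trans (by norm_num) (le_max_left _ _)
    exact le_trans (Nat.pow_le_pow_left h1 4) hD₁n
  have hexp2000 : Real.exp 2000 ≤ (n : ℝ) ^ q := exp_2000_le_pow (by omega) h600
  have hT4 : 2 * (4 : ℝ) ^ q * Real.exp 1 ^ (q + 1) * (Real.exp 2000 * Real.sqrt Pstar) ≤ Real.exp (-(a * dq n)) / 30 := by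
    have hsq : 0 ≤ Real.sqrt Pstar := Real.sqrt_nonneg _
    have h1 : 2 * (4 : ℝ) ^ q * Real.exp 1 ^ (q + 1) * (Real.exp 2000 * Real.sqrt Pstar) ≤
        2 * (Real.exp 1 ^ (q + 1) * (n : ℝ) ^ q * ((4 : ℝ) ^ q * Real.sqrt Pstar)) := by
      have := mul_le_mul_of_nonneg_right hexp2000 (mul_nonneg (by positivity : (0 : ℝ) ≤ 2 * 4 ^ q * Real.exp 1 ^ (q + 1)) hsq)
      nlinarith [this]
    linarith
  rw [hAeq]
  refine h3.trans ?_
  have hsum : (Real.exp 1 ^ (q + 1))⁻¹ + Real.exp 1 ^ (q + 1) * (n : ℝ) ^ q *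
        ((4 : ℝ) ^ q * Real.sqrt (∏ j ∈ range ((Dg - 4) / 2 + 1), ((2 * j + 1 : ℝ) / ((n : ℝ) - 2 * j)))) +
        2 * (4 : ℝ) ^ q * Real.exp 1 ^ (q + 1) * (Real.exp 2000 * Real.sqrt Pstar + Real.exp (-(c₀ * ((dq n : ℝ) - 1)))) ≤
      Real.exp (-(a * dq n)) := by
    have hT3' : 2 * (4 : ℝ) ^ q * Real.exp 1 ^ (q + 1) * Real.exp (-(c₀ * ((dq n : ℝ) - 1))) ≤ Real.exp (-(a * dq n)) / 6 := hT3
    nlinarith [hT1, hT2, hT3', hT4, Real.exp_pos (-(a * dq n))]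
  exact mul_le_mul_of_nonneg_left hsum hBv

/-- **NTF mod KL for the route's designs: the squared-slack reweighting decays on ALL rectangles.** Under `GlobalLevelDInequality` there are
`a > 0`, `n₁` with: for even `n ≥ n₁`, every balanced exact design `(t, C, w)` of degree `dq n` on levels `≤ Tq n` with `Σ|w_c| ≤ 20`, and
EVERY rectangle `A × Y`: `Σ_{U∈A} Σ_{M∈Y} W̃(U,M) ≤ 20·Tq(n)²·exp(−a·dq n)`, `W̃ = levelWeight n t C (c ↦ w_c (c−1)²) = W·(cc−1)²`
(brick 43 `levelWeight_sqSlack`). The necessary condition of the crux at dimension `C(n,2)+1` (lit g16 I15), modulo KL Thm 1.8.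
[cite: KeevashLifshitz2023, Thm. 1.8] [cite: Rothvoss2017, §2 (PDF p. 6)] -/
theorem rectangleSqSlackDecay_of_globalLevelD (hKL : GlobalLevelDInequality) :
    ∃ a : ℝ, 0 < a ∧ ∃ n₁ : ℕ, ∀ n : ℕ, n₁ ≤ n → Even n → ∀ (t : ℕ) (C : Finset ℕ) (w : ℕ → ℝ),
      IsBalancedDesign n t (Tq n) (dq n) 20 C w →
        ∀ (A : Finset (OddSet n)) (B : Finset (PMatch n)),
          ∑ U ∈ A, ∑ M ∈ B, levelWeight n t C (fun c => w c * ((c : ℝ) - 1) ^ 2) U M ≤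
            20 * (Tq n : ℝ) ^ 2 * Real.exp (-(a * (dq n : ℝ))) := by
  obtain ⟨a, ha, n₁, h⟩ := rectangleDecayAll_of_globalLevelD hKL
  refine ⟨a, ha, max n₁ (3 ^ 4), fun n hn hev t C w hdes A B => ?_⟩
  have hn₁ : n₁ ≤ n := le_trans (le_max_left _ _) hn
  have h81 : 3 ^ 4 ≤ n := le_trans (le_max_right _ _) hn
  have hD3 : 3 ≤ dq n := by
    unfold dq; rw [Nat.le_sqrt, Nat.le_sqrt]; exact le_trans (by norm_num) h81
  have hsq := isBalancedDesign_sqSlack hdes hD3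
  obtain ⟨hex, hbal⟩ := hsq
  obtain ⟨c', hc'⟩ := hex.1
  rw [hc'] at hex hbal ⊢
  exact h n hn₁ hev c' (Tq n) (dq n - 2) (20 * (Tq n : ℝ) ^ 2) C _ hex hbal le_rfl (by omega) (by omega) A B

/-- **The `r = 1` rung WITHOUT tight-freeness (mod KL).** Under `GlobalLevelDInequality` there are `a > 0`, `n₁` with: for even `n ≥ n₁`,
every balanced exact design `(t, C, w)` of degree `dq n` on levels `≤ Tq n` with `Σ|w_c| ≤ 20`, and EVERY rectangle `A × Y` (tight-free or
not): `Σ_{U∈A} Σ_{M∈Y} W(U,M) ≤ 20·exp(−a·dq n)`. Brick 32's `rectangleDecayExp_of_globalLevelD` (tight-free rectangles, via the SNT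
contradiction) is the special case; this is a second proof of it, via virtual nonnegativity of spread cells (brick 46).
[cite: KeevashLifshitz2023, Thm. 1.8] [cite: Rothvoss2017, §2 and Lemma 7 (PDF pp. 6–8)] [cite: KupavskiiZakharov2022, Lemma 11] -/
theorem rectangleDecayExp_all_of_globalLevelD (hKL : GlobalLevelDInequality) :
    ∃ a : ℝ, 0 < a ∧ ∃ n₁ : ℕ, ∀ n : ℕ, n₁ ≤ n → Even n → ∀ (t : ℕ) (C : Finset ℕ) (w : ℕ → ℝ),
      IsBalancedDesign n t (Tq n) (dq n) 20 C w →
        ∀ (A : Finset (OddSet n)) (B : Finset (PMatch n)),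
          ∑ U ∈ A, ∑ M ∈ B, levelWeight n t C w U M ≤ 20 * Real.exp (-(a * (dq n : ℝ))) := by
  obtain ⟨a, ha, n₁, h⟩ := rectangleDecayAll_of_globalLevelD hKL
  refine ⟨a, ha, n₁, fun n hn hev t C w hdes A B => ?_⟩
  obtain ⟨hex, hbal⟩ := hdes
  obtain ⟨c', hc'⟩ := hex.1
  rw [hc'] at hex hbal ⊢
  exact h n hn hev c' (Tq n) (dq n) 20 C w hex hbal le_rfl (by omega) le_rfl A B

end Summit.PneNP.PneNP.Theorems.ChebyshevTracialDesignRectangleDecayAll
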